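import Summits.MatrixMultiplication.MatrixMultiplication.Theorems.GradedDesignFamily.Negative.SubfieldCellNineSingerHarmonic
/-!
# Subfield cell `GL₂(𝔽₉) ⊃ SL₂(𝔽₃)` at level one — XIIIb: no separated Singer interval of length 13 in the harmonic cycle

**Honest framing.** VALUE = one kernel-checked NEGATIVE FACT about ONE finite cell (`|k| = 3`, `|K| = 9`) of ONE skeleton
line (`quadratic_extension_level_one_cell`, stub S3 `stub_subfieldCell`, crux `GradedDesignFamily`, route
`LevelGradedCohnUmans`).  Not summit progress (no bound on `ω`); it does not bear on the asymptotic stub.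

This is the corollary announced (but not declared) in file XIII (`SubfieldCellNineSingerHarmonic`): in the *harmonic* Singer
cycle `C = ⟨η₀⟩ ≤ GL₂(𝔽₉)` (`η₀ = [[0,1],[1+i,2+i]]`, cross-ratio class `λ = 2`), NO right translate of the Singer interval
`{η₀, η₀², …, η₀¹³}` is level-one separated against any non-empty `Y` — because that interval contains
`η₀ · {1, μ, μ², μ³}` with `μ = η₀⁴`, which file XIII (`subfieldCell_nine_harmonic_noFour_1`, a `±1` row-one dual certificate)
obstructs.  Contrast (SUBFIELD.md §22, certified in characteristic 0, not formalised): in the 24 cycles with `λ ∉ 𝔽₃` the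
interval of length 19 IS separated (it meets the counting wall `|Y| + |Z| ≤ 20`), and in the harmonic cycle length 12 is.

Implementation note (gen 18): the only computation is `μ^m · η₀ ∈ {η₀^(n+1) : n < 13}` (`m ≤ 3`), checked by `native_decide`
in Boolean form (`List.all`/`List.elem`, see the docstring of `muL_1_mul_eta0_elem` for why the propositional form is slow);
no new definitions (a first version, p331068, carried the 13 interval elements as literals, decided membership
propositionally and exceeded the gate's 600 s elaboration budget).
-/

set_option linter.dupNamespace false

namespace Summit.MatrixMultiplication.MatrixMultiplication.Theorems.GradedDesignFamily.Negative.SubfieldNine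

open Matrix

/-- `μ^m · η₀ ∈ {η₀, …, η₀¹³}` for `μ^m ∈ muL_1 = [1, μ, μ², μ³]`, `μ = η₀⁴` — in Boolean form (`List.all` / `List.elem`),
so that `native_decide` evaluates the 4 products directly.  (The propositional form `∀ z ∈ muL_1, …` is decided by Lean through
`Fintype.decidableForallFintype`, i.e. by enumerating `GL₂(𝔽₉)` as the units among all `6561²` pairs of matrices — that is what
pushed p331068 past the 600 s budget.) -/
theorem muL_1_mul_eta0_elem :
    (muL_1.all fun z => List.elem (z * eta0) ((List.range 13).map fun n => eta0 ^ (n + 1))) = true := by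
  native_decide

/-- **No separated Singer interval of length 13 in the harmonic cycle**: for every `g ∈ GL₂(𝔽₉)`, every non-empty `Y` and
every `Z ⊇ {η₀ g, η₀² g, …, η₀¹³ g}`, the pair `(Y, Z)` is not level-one separated (`IsSep`).  Finite-cell negative fact,
NOT summit progress. -/
theorem subfieldCell_nine_harmonicSinger_interval13 {Y Z : Finset (GL (Fin 2) K)} (g : GL (Fin 2) K)
    (hY : Y.Nonempty) (hZ : ∀ n < 13, eta0 ^ (n + 1) * g ∈ Z) : ¬ IsSep Y Z := by
  refine subfieldCell_nine_harmonic_noFour_1 (eta0 * g) hY fun z hz => ?_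
  have hmem : z * eta0 ∈ (List.range 13).map (fun n => eta0 ^ (n + 1)) :=
    List.mem_of_elem_eq_true (List.all_eq_true.mp muL_1_mul_eta0_elem z hz)
  obtain ⟨n, hn, he⟩ := List.mem_map.mp hmem
  rw [← mul_assoc, ← he]
  exact hZ n (List.mem_range.mp hn)

end Summit.MatrixMultiplication.MatrixMultiplication.Theorems.GradedDesignFamily.Negative.SubfieldNine
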